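/-
Copyright (c) 2026 the pub-hodgecm-mathlib formalisation cell (harness21).  Prover seat hodgecm-mathlib-K2Liu-p02 (g0),
Track B «K2-LIT» ∕ hLiu418 #184♮, unit U4 «POLE AND SEE-SAW» of the K2_Liu road, socket s6: payment of
`K2LiuCurveThetaSigsU4PoleAndSeesaw.sig_K2LiuSeesawFubini` — (O6) THE SEE-SAW EXCHANGE OVER THE COMPACT `[U(⟨a′⟩)]`.  2026-09-03.
-/
import Literature.NumberTheory.Automorphic.Liu2021.CurveThetaNonOrthogonal               -- ♮ frame tokens (`rhoVAtLine`, `lineThetaKernelDatum`, …)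
import Summits.HodgeConjecture.HodgeConjecture.Theorems.F0LD1ScalarFrameTransport        -- ★ `hasThetaMajorants_lineThetaKernelDatum₂`
import Literature.NumberTheory.K2Lit.SiegelEisensteinSeriesDoubled                      -- ★ `siegelDeltaCharacter` (the unfolded twist)
import Literature.NumberTheory.K2Lit.DoublingZetaIntegral                               -- ★ `doublingPairing`, `iotaV`
import Summits.HodgeConjecture.HodgeConjecture.Theorems.F0LD1ThetaAdjunctionOfClass      -- ★ (T1) the adjunction, kernel slices, transport
import Summits.HodgeConjecture.HodgeConjecture.Theorems.F0LD2FrameTransportPin           -- ★ `continuous_of_pin`, `mem_range_toAdelic_of_pin`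
import HarnessLib

/-!
# K2_Liu road (hLiu418 = stmt-HodgeConjecture-24832), unit U4 «POLE AND SEE-SAW», socket s6:
# (O6) the see-saw exchange over the compact `[U(⟨a′⟩)]` — a non-zero see-saw doubling pairing forces a non-zero opposite theta lift

Cell `pub/hodgecm-mathlib` (D-0151), Track B (21-frontier RULING «PUSH BOTH» 2026-09-03; LEAD F0P6-plan PRE-DEAL BY NAME 2026-09-03T21:38:16Z: s6 ↦ base
K2Liu-p02), socket module `Summits/HodgeConjecture/HodgeConjecture/Cruxes/HLiu418/Lines/K2_Liu_CurveThetaSigs_U4_PoleAndSeesaw.lean` ED. 2 (planner K2Liu-plan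
(g0)), socket **`sig_K2LiuSeesawFubini`** (s6; = the tier-0 line's stub `SeesawFubini` of `Cruxes/HLiu418/Lines/K2_Liu_CurveThetaNonOrthogonal.lean` rev. d BY
VALUE).  In the frame of the curve letters (★ `Liu2021.curveTheta_nonOrthogonal₂`): a discrete automorphic `P` of the CM unitary curve `G = U(H)`, two
Schwartz–Bruhat data `Φ₁, Φ₂`, `w, w′ ∈ P`, the theta kernels `θ_{Φᵢ}` of the line `⟨a′⟩` (★ `lineThetaKernelDatum`, majorants ★
`hasThetaMajorants_lineThetaKernelDatum₂`) read on `[G]` through the pinned transport `ιA` (★ `toQuotFun`), the see-saw kernel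
`K(x₁, x₂) = ∫ conj κ¹_q(x₁) κ²_q(x₂) dν(q)` and its doubling pairing ★ `K2Lit.SiegelDoubled.doublingPairing` against `w` and the TWISTED `χ_{D,½} · w′`.
CLAIM: pairing `≠ 0` ⟹ `∃ Φ w₀ ∈ P, q₀` with `Θᵗ_Φ(w̄₀)(q₀) = ∫_{[G]} conj(w₀) κ^Φ_{q₀} dμ ≠ 0` (take `Φ := Φ₁`, `w₀ := w`).

THE MATHEMATICS — the see-saw [HarrisKudlaSweet1996 §1 L1.1; Liu 2021 App. B §B.1, Thm. B.4 (1)(c)] as an ADJUNCTION, not a Fubini: (J) the inner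
integral `∫_{x₁} K(x₁,x₂) w(x₁) dμ` is, after conjugation, the pairing `⟪w, [Θ̃_{Φ₁}(f₂) ∘ ιA]⟫` of the `L²`-class `w` with the theta lift of the continuous
weight `f₂ = conj θ_{Φ₂}(aQ x₂, ·)` on `[U(⟨a′⟩)]`, and ★ (T1) `inner_toLp_lineThetaLift_eq_integral` (the two lifts of one kernel are adjoint — proved in the
tree with `C([G], ℂ)`-valued Bochner integrals, WITHOUT product measures) turns it into `∫_q Θᵗ_{Φ₁}(w̄)(q) f₂(q) dν`, which is `0` if the opposite lift
vanishes identically; then the doubling pairing on `[G] × [G]` is `0` by Mathlib's `integral_prod_symm` when integrable and by the junk value otherwise — the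
twisted slot is never inspected.

* §1 **`seesawFubini`** — `sig_K2LiuSeesawFubini` TOKEN FOR TOKEN (one theorem; the intermediate identities are `have`s on the frame's binders).

HONEST LABEL: HC_CM is proved only modulo the 7 printed citations (2 remaining named inputs: hLiu418 = stmt-HodgeConjecture-24832, h413 =
stmt-HodgeConjecture-24833) until rung 0 closes; this file is a `--supports stmt-HodgeConjecture-24832` helper (it discharges the line's stub s6 BY VALUE) and
retires nothing by itself.
-/

set_option autoImplicit false
-- statements over the theta-kernel datum elaborate to very large types; elaborate sequentially (as in ★ `F0LD1ThetaAdjunctionOfClass`)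
set_option Elab.async false

noncomputable section

open NumberField NumberField.InfinitePlace MeasureTheory IsDedekindDomain
open scoped Matrix ComplexOrder ENNReal InnerProductSpace ComplexConjugate
open scoped NNReal Topology
open Filter Complex Set
open Literature.NumberTheory.Automorphic Literature.NumberTheory.Automorphic.UnitaryGroup
open Literature.NumberTheory.Automorphic.UnitaryGroup.CotangentForms
open Literature.NumberTheory.Automorphic.UnitaryCurveForms
open Literature.NumberTheory.Automorphic.IdeleClassGroup
open Literature.NumberTheory.Automorphic.Liu2021
open Literature.NumberTheory.Automorphic.Liu2021.Def411WeilCarriers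
open Literature.NumberTheory.Automorphic.Liu2021.Def411WeilCarriersDoubling
open Literature.NumberTheory.GaloisRepresentations
open Literature.NumberTheory.GelbartRogawski1991 Literature.NumberTheory.GelbartRogawski1991.UnitaryDualPair
open Literature.NumberTheory.GelbartRogawski1991.GRConstruction (HA)
open Literature.NumberTheory.Weil1964
open Literature.RepresentationTheory.Liu2021 Literature.RepresentationTheory.HarrisKudlaSweet1996
open Literature.MeasureTheory.Integral

namespace Summit.HodgeConjecture.HodgeConjecture.Cruxes.HLiu418.K2LiuSeesawFubini

open _root_.MeasureTheory
open Summit.HodgeConjecture.HodgeConjecture.Cruxes.HLiu418.F0LD1ThetaTransportKit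
open Summit.HodgeConjecture.HodgeConjecture.Cruxes.HLiu418.F0LD1ThetaAdjunctionOfClass
open Summit.HodgeConjecture.HodgeConjecture.Cruxes.HLiu418.F0LD2FrameTransportPin (continuous_of_pin mem_range_toAdelic_of_pin)
open Summit.HodgeConjecture.HodgeConjecture.Cruxes.HLiu418.F0LD1ScalarFrameTransport (hasThetaMajorants_lineThetaKernelDatum₂)

set_option maxHeartbeats 1000000 in -- the theta-kernel datum's statement telescope (≈ 60 binders) + five kernel-sized `have`s
/-- **PAYMENT OF `sig_K2LiuSeesawFubini`** (socket s6 of unit U4 «POLE AND SEE-SAW» of the K2_Liu road,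
`Cruxes/HLiu418/Lines/K2_Liu_CurveThetaSigs_U4_PoleAndSeesaw.lean` ED. 2, TOKEN FOR TOKEN; = the tier-0 line's stub s6 `SeesawFubini` BY VALUE).
**(O6) SEE-SAW over the compact `[U(⟨a′⟩)]`**: if for some finite invariant open-positive Borel `ν` on `[U(⟨a′⟩)]` the doubling pairing of the see-saw
kernel `K(x₁, x₂) = ∫_{[U(⟨a′⟩)]} conj κ¹_q(x₁) · κ²_q(x₂) dν(q)` (`κⁱ_q` = the theta kernel `θ_{Φᵢ}` read on `[G]` through the pinned transport `ιA`)
against `w` and the twisted `w′` is non-zero, then the OPPOSITE LIFT `Θᵗ_{Φ₁}(w̄)(q₀) = ∫_{[G]} conj(w) κ¹_{q₀} dμ` is non-zero at some `q₀` (witnesses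
`(Φ, w₀) := (Φ₁, w)`).  PROOF.  Suppose `Θᵗ_{Φ₁}(w̄) ≡ 0`.  (J) For every `x₂`, `∫_{x₁} K(x₁, x₂) w(x₁) dμ = 0`: its CONJUGATE is
`∫ conj(w α) · (∫_q κ¹_q(α) · conj κ²_q(x₂) dν) dμ = ⟪w, [Θ̃_{Φ₁}(f₂) ∘ ιA]⟫` for the continuous weight `f₂(q) = conj θ_{Φ₂}(aQ x₂, q)` (★
`toQuotFun_lineThetaLift_eq_integral_toQuotFun_thetaKer`, `aQ` = ★ `exists_quotientTransport` of the pinned `ιA`, ★ `continuous_of_pin` ∕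
`mem_range_toAdelic_of_pin`), which the ADJUNCTION of the two theta lifts of one kernel ★ `F0LD1ThetaAdjunctionOfClass.inner_toLp_lineThetaLift_eq_integral`
(T1; `C([G], ℂ)`-valued Bochner integral — no product measure, no second countability) rewrites as `∫_q Θᵗ_{Φ₁}(w̄)(q) f₂(q) dν = 0`.  Then the doubling
pairing `∫_{[G]×[G]} K(x) w(x₁) conj φ₂(x₂) d(μ ⊗ μ)` vanishes: if the integrand is not integrable it is the junk `0` (Mathlib `integral_undef`); otherwise
Mathlib `integral_prod_symm` + `integral_mul_const` give `∫_{x₂} (J(x₂)) · conj φ₂(x₂) dμ = 0` — NO measurability or structure of the twisted slot `φ₂` is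
used (A-plan2's (V5) remark, certified).  [cite: HarrisKudlaSweet1996, §1 L1.1] [cite: Liu2021, App. B §B.1 (p. 97 L10–18); Thm. B.4 (1)(c) (p. 98)]
[cite: FleigEtAl2018, §12.3 Def. 12.5 (12.37)–(12.38) p. 296] -/
theorem seesawFubini :
  ∀ (L : Type) [Field L] [NumberField L] [IsCMField L] (ι : L →+* ℂ) (H : Matrix (Fin 2) (Fin 2) L)
    (dV : Fin 2 → L) (hdV : ∀ i, IsCMField.complexConj L (dV i) = dV i) (hdV0 : ∀ i, dV i ≠ 0)
    (t : L) (ht : t ≠ 0) (g : GL (Fin 2) L)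
    (hg : formCongr ((IsCMField.complexConj L : L ≃ₐ[↥(maximalRealSubfield L)] L) : L →+* L) g (t • H) = Matrix.diagonal dV),
    (∃ T : GL (Fin 2) ℂ, formCongr (starRingEnd ℂ) T ((Matrix.diagonal dV).map ι) = Matrix.diagonal ![(1 : ℂ), -1]) →
    ∀ (hpos : ∀ τ' : L →+* ℂ, InfinitePlace.mk τ' ≠ InfinitePlace.mk ι → ((Matrix.diagonal dV).map τ').PosDef),
    4 ≤ Module.finrank ℚ L →
    ∀ (μ : Measure (adelicGroupData (↥(maximalRealSubfield L)) L (IsCMField.complexConj L) 2 H).automorphicQuotient)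
      [(adelicGroupData (↥(maximalRealSubfield L)) L (IsCMField.complexConj L) 2 H).IsAutomorphicMeasure μ]
      {n' : ℕ} (e₁ : Fin 2 × Fin 1 ≃ Fin n')
      (lam : Literature.NumberTheory.Automorphic.IdeleClassGroup L →ₜ* Circle) (hlam : IsConjugateSymplectic L lam), HasWeight L lam 1 →
    ∀ (a : (↥(maximalRealSubfield L))ˣ) (χ : Chi (↥(maximalRealSubfield L)) L (IsCMField.complexConj L))
      (W : Type) [AddCommGroup W] [Module ℂ W]
      (σ : Representation ℂ (finAdelic (↥(maximalRealSubfield L)) L (IsCMField.complexConj L) 2 H) W),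
      σ.IsIrreducible → σ.IsSmooth →
    ∀ j : σ.IntertwiningMap
        ((rhoVAtLine (↥(maximalRealSubfield L)) L (IsCMField.complexConj L) 2 e₁ (Matrix.diagonal dV)
            (complexConj_imagUnit L) (imagUnit_ne_zero L) (imagUnit_mul_self L) (realDiagonal_isSymm L dV hdV)
            (isUnit_det_realDiagonal L dV hdV hdV0) (realDiagonal_map L dV hdV).symm
            (fun a => isCompatible_chiSplittingLine L e₁ dV hdV hdV0 (toHeckeCharacter L lam)
              (isUnitary_toHeckeCharacter L lam) ((isOscillatorChar_toHeckeCharacter_iff lam).mpr hlam)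
              (TW (↥(maximalRealSubfield L)) a) (isSymm_TW (↥(maximalRealSubfield L)) a)
              (isUnit_det_TW (↥(maximalRealSubfield L)) a) (JW (↥(maximalRealSubfield L)) L a)
              (JW_eq (↥(maximalRealSubfield L)) L a)) a χ).comp
          (finAdelicCongr (↥(maximalRealSubfield L)) L (IsCMField.complexConj L) g ht hg).symm.toMonoidHom),
      Function.Injective j →
    ∀ (ιA : (adelicGroupData (↥(maximalRealSubfield L)) L (IsCMField.complexConj L) 2 H).Adelic →*
        ↥(UnitaryGroup.adelic (↥(maximalRealSubfield L)) L (IsCMField.complexConj L) 2 (Matrix.diagonal dV))),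
      (∀ k, ((ιA k : ↥(UnitaryGroup.adelic (↥(maximalRealSubfield L)) L (IsCMField.complexConj L) 2 (Matrix.diagonal dV))) :
            GL (Fin 2) (AdeleRing (𝓞 L) L)) =
          (toAdeleGL L g)⁻¹ * adelicVal (↥(maximalRealSubfield L)) L (IsCMField.complexConj L) 2 H k * toAdeleGL L g) →
    ∀ [CompactSpace (↥(UnitaryGroup.adelic (↥(maximalRealSubfield L)) L (IsCMField.complexConj L) 2 (Matrix.diagonal dV)) ⧸
        (UnitaryGroup.toAdelic (↥(maximalRealSubfield L)) L (IsCMField.complexConj L) 2 (Matrix.diagonal dV)).range)]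
      [CompactSpace (adelicGroupData (↥(maximalRealSubfield L)) L (IsCMField.complexConj L) 2 H).automorphicQuotient],
    ∀ P : DiscreteAutomorphicRep (adelicGroupData (↥(maximalRealSubfield L)) L (IsCMField.complexConj L) 2 H) μ,
      P.HasFinComponent σ →
      ∀ (a' : (↥(maximalRealSubfield L))ˣ) (Φ₁ Φ₂ : piSchwartzBruhat (↥(maximalRealSubfield L)) (Fin n'))
        (w : (adelicGroupData (↥(maximalRealSubfield L)) L (IsCMField.complexConj L) 2 H).L2 μ), w ∈ P.space.toSubmodule → ∀ (w' : (adelicGroupData (↥(maximalRealSubfield L)) L (IsCMField.complexConj L) 2 H).L2 μ), w' ∈ P.space.toSubmodule →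
      (letI : MeasurableSpace (↥(UnitaryGroup.adelic (↥(maximalRealSubfield L)) L (IsCMField.complexConj L) 1 (JW (↥(maximalRealSubfield L)) L a')) ⧸ (UnitaryGroup.toAdelic (↥(maximalRealSubfield L)) L (IsCMField.complexConj L) 1 (JW (↥(maximalRealSubfield L)) L a')).range) := borel _
        ∃ (ν : Measure (↥(UnitaryGroup.adelic (↥(maximalRealSubfield L)) L (IsCMField.complexConj L) 1 (JW (↥(maximalRealSubfield L)) L a')) ⧸ (UnitaryGroup.toAdelic (↥(maximalRealSubfield L)) L (IsCMField.complexConj L) 1 (JW (↥(maximalRealSubfield L)) L a')).range))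
          (_ : IsFiniteMeasure ν) (_ : SMulInvariantMeasure ↥(UnitaryGroup.adelic (↥(maximalRealSubfield L)) L (IsCMField.complexConj L) 1 (JW (↥(maximalRealSubfield L)) L a')) (↥(UnitaryGroup.adelic (↥(maximalRealSubfield L)) L (IsCMField.complexConj L) 1 (JW (↥(maximalRealSubfield L)) L a')) ⧸ (UnitaryGroup.toAdelic (↥(maximalRealSubfield L)) L (IsCMField.complexConj L) 1 (JW (↥(maximalRealSubfield L)) L a')).range) ν) (_ : ν.IsOpenPosMeasure),
          Literature.NumberTheory.K2Lit.SiegelDoubled.doublingPairing (adelicGroupData (↥(maximalRealSubfield L)) L (IsCMField.complexConj L) 2 H) μ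
            (fun x => ∫ q, conj (toQuotFun (adelicGroupData (↥(maximalRealSubfield L)) L (IsCMField.complexConj L) 2 H)
                (fun y => (lineThetaKernelDatum L 2 e₁ dV hdV hdV0 lam hlam a'
              (hasThetaMajorants_lineThetaKernelDatum₂ L ι e₁ dV hdV hdV0 hpos lam hlam a')).thetaKer Φ₁
                (QuotientGroup.mk (ιA y)⁻¹, q)) x.1) *
              toQuotFun (adelicGroupData (↥(maximalRealSubfield L)) L (IsCMField.complexConj L) 2 H)
                (fun y => (lineThetaKernelDatum L 2 e₁ dV hdV hdV0 lam hlam a'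
              (hasThetaMajorants_lineThetaKernelDatum₂ L ι e₁ dV hdV hdV0 hpos lam hlam a')).thetaKer Φ₂
                (QuotientGroup.mk (ιA y)⁻¹, q)) x.2 ∂ν)
            (fun α => w α) (fun α =>
              Literature.NumberTheory.K2Lit.SiegelDoubled.siegelDeltaCharacter L e₁ dV hdV (fun _ : Fin 1 => (1 : L)) (fun _ => map_one _)
                (toHeckeCharacter L lam) (1 / 2)
                (Literature.NumberTheory.K2Lit.SiegelDoubled.iotaV L e₁ dV hdV (fun _ : Fin 1 => (1 : L)) (fun _ => map_one _)
                  (ιA ((Quotient.out (α : (adelicGroupData (↥(maximalRealSubfield L)) L (IsCMField.complexConj L) 2 H).Adelic ⧸ (adelicGroupData (↥(maximalRealSubfield L)) L (IsCMField.complexConj L) 2 H).quotientSubgroup)) : (adelicGroupData (↥(maximalRealSubfield L)) L (IsCMField.complexConj L) 2 H).Adelic)⁻¹,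
                   ιA ((Quotient.out (α : (adelicGroupData (↥(maximalRealSubfield L)) L (IsCMField.complexConj L) 2 H).Adelic ⧸ (adelicGroupData (↥(maximalRealSubfield L)) L (IsCMField.complexConj L) 2 H).quotientSubgroup)) : (adelicGroupData (↥(maximalRealSubfield L)) L (IsCMField.complexConj L) 2 H).Adelic)⁻¹)) *
              w' α) ≠ 0) →
      ∃ (Φ : piSchwartzBruhat (↥(maximalRealSubfield L)) (Fin n')) (w₀ : (adelicGroupData (↥(maximalRealSubfield L)) L (IsCMField.complexConj L) 2 H).L2 μ) (_ : w₀ ∈ P.space.toSubmodule)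
        (q₀ : (↥(UnitaryGroup.adelic (↥(maximalRealSubfield L)) L (IsCMField.complexConj L) 1 (JW (↥(maximalRealSubfield L)) L a')) ⧸ (UnitaryGroup.toAdelic (↥(maximalRealSubfield L)) L (IsCMField.complexConj L) 1 (JW (↥(maximalRealSubfield L)) L a')).range)),
        ∫ α, conj (w₀ α) * toQuotFun (adelicGroupData (↥(maximalRealSubfield L)) L (IsCMField.complexConj L) 2 H)
          (fun y => (lineThetaKernelDatum L 2 e₁ dV hdV hdV0 lam hlam a'
              (hasThetaMajorants_lineThetaKernelDatum₂ L ι e₁ dV hdV hdV0 hpos lam hlam a')).thetaKer Φ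
                (QuotientGroup.mk (ιA y)⁻¹, q₀)) α ∂μ ≠ 0 := by
  intro L _ _ _ ι H dV hdV hdV0 t ht g hg hT hpos h4 μ _ n' e₁ lam hlam hwt a χ W _ _ σ hirr hsm j hj ιA hιA _ _ P hfin a' Φ₁ Φ₂
    w hw w' hw' hyp
  -- Borel data, normality and compactness of `[U(⟨a′⟩)]`
  letI : MeasurableSpace (↥(UnitaryGroup.adelic (↥(maximalRealSubfield L)) L (IsCMField.complexConj L) 1 (JW (↥(maximalRealSubfield L)) L a')) ⧸
      (UnitaryGroup.toAdelic (↥(maximalRealSubfield L)) L (IsCMField.complexConj L) 1 (JW (↥(maximalRealSubfield L)) L a')).range) := borel _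
  haveI : BorelSpace (↥(UnitaryGroup.adelic (↥(maximalRealSubfield L)) L (IsCMField.complexConj L) 1 (JW (↥(maximalRealSubfield L)) L a')) ⧸
      (UnitaryGroup.toAdelic (↥(maximalRealSubfield L)) L (IsCMField.complexConj L) 1 (JW (↥(maximalRealSubfield L)) L a')).range) := ⟨rfl⟩
  haveI := normal_range_toAdelic_JW L a'
  haveI := compactSpace_quotient_range_toAdelic_JW L a'
  obtain ⟨ν, hνfin, hνinv, hνpos, hne⟩ := hyp
  -- the pinned transport is continuous and carries rational points to rational points
  have hιA' : Continuous ιA ∧ ∀ ⦃γ : (adelicGroupData (↥(maximalRealSubfield L)) L (IsCMField.complexConj L) 2 H).Adelic⦄,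
      γ ∈ (UnitaryGroup.toAdelic (↥(maximalRealSubfield L)) L (IsCMField.complexConj L) 2 H).range →
        ιA γ ∈ (UnitaryGroup.toAdelic (↥(maximalRealSubfield L)) L (IsCMField.complexConj L) 2 (Matrix.diagonal dV)).range :=
    ⟨continuous_of_pin L 2 H dV g ιA hιA, fun _ hγ => mem_range_toAdelic_of_pin L 2 H dV t ht g hg ιA hιA hγ⟩
  refine ⟨Φ₁, w, hw, ?_⟩
  by_contra hall
  push Not at hall
  refine hne ?_
  -- the kernel slices on `[U(H)]`, read through a transport `aQ` on the quotients
  obtain ⟨aQ, haQ⟩ := exists_quotientTransport L 2 H dV ιA hιA'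
  have hκ₂ : ∀ q α, toQuotFun (adelicGroupData (↥(maximalRealSubfield L)) L (IsCMField.complexConj L) 2 H)
      (fun y => (lineThetaKernelDatum L 2 e₁ dV hdV hdV0 lam hlam a'
        (hasThetaMajorants_lineThetaKernelDatum₂ L ι e₁ dV hdV hdV0 hpos lam hlam a')).thetaKer Φ₂ (QuotientGroup.mk (ιA y)⁻¹, q)) α =
      (lineThetaKernelDatum L 2 e₁ dV hdV hdV0 lam hlam a'
        (hasThetaMajorants_lineThetaKernelDatum₂ L ι e₁ dV hdV hdV0 hpos lam hlam a')).thetaKer Φ₂ (aQ α, q) := fun q α =>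
    toQuotFun_thetaKer_eq_of_quotientTransport L 2 H e₁ dV hdV hdV0 ιA hιA' lam hlam a' _ Φ₂ aQ haQ q α
  -- (J) for every `x₂`: `∫ K(x₁,x₂) w(x₁) dμ(x₁) = 0` — by the adjunction ★ (T1) with the continuous weight `q ↦ conj θ_{Φ₂}(aQ x₂, q)`
  have hJ : ∀ x₂ : (adelicGroupData (↥(maximalRealSubfield L)) L (IsCMField.complexConj L) 2 H).automorphicQuotient,
      ∫ x₁, (∫ q, conj (toQuotFun (adelicGroupData (↥(maximalRealSubfield L)) L (IsCMField.complexConj L) 2 H)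
          (fun y => (lineThetaKernelDatum L 2 e₁ dV hdV hdV0 lam hlam a'
            (hasThetaMajorants_lineThetaKernelDatum₂ L ι e₁ dV hdV hdV0 hpos lam hlam a')).thetaKer Φ₁ (QuotientGroup.mk (ιA y)⁻¹, q)) x₁) *
        toQuotFun (adelicGroupData (↥(maximalRealSubfield L)) L (IsCMField.complexConj L) 2 H)
          (fun y => (lineThetaKernelDatum L 2 e₁ dV hdV hdV0 lam hlam a'
            (hasThetaMajorants_lineThetaKernelDatum₂ L ι e₁ dV hdV hdV0 hpos lam hlam a')).thetaKer Φ₂ (QuotientGroup.mk (ιA y)⁻¹, q)) x₂ ∂ν) *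
        w x₁ ∂μ = 0 := by
    intro x₂
    -- the continuous weight `f₂(q) = conj θ_{Φ₂}(aQ x₂, q)`
    set g₂ : C((↥(UnitaryGroup.adelic (↥(maximalRealSubfield L)) L (IsCMField.complexConj L) 1 (JW (↥(maximalRealSubfield L)) L a')) ⧸
        (UnitaryGroup.toAdelic (↥(maximalRealSubfield L)) L (IsCMField.complexConj L) 1 (JW (↥(maximalRealSubfield L)) L a')).range), ℂ) :=
      ((lineThetaKernelDatum L 2 e₁ dV hdV hdV0 lam hlam a'
        (hasThetaMajorants_lineThetaKernelDatum₂ L ι e₁ dV hdV hdV0 hpos lam hlam a')).thetaKer Φ₂).comp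
        ((ContinuousMap.const _ (aQ x₂)).prodMk (ContinuousMap.id _)) with hg₂
    have hg₂ap : ∀ q, g₂ q = (lineThetaKernelDatum L 2 e₁ dV hdV hdV0 lam hlam a'
        (hasThetaMajorants_lineThetaKernelDatum₂ L ι e₁ dV hdV hdV0 hpos lam hlam a')).thetaKer Φ₂ (aQ x₂, q) := fun q => rfl
    have hf₂ap : ∀ q, (star g₂) q = conj (toQuotFun (adelicGroupData (↥(maximalRealSubfield L)) L (IsCMField.complexConj L) 2 H)
          (fun y => (lineThetaKernelDatum L 2 e₁ dV hdV hdV0 lam hlam a'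
            (hasThetaMajorants_lineThetaKernelDatum₂ L ι e₁ dV hdV hdV0 hpos lam hlam a')).thetaKer Φ₂ (QuotientGroup.mk (ιA y)⁻¹, q)) x₂) := fun q => by
      rw [ContinuousMap.star_apply, Complex.star_def, hg₂ap, hκ₂]
    -- ★ (T1): `⟪w, [Θ̃_{Φ₁}(star g₂) ∘ ιA]⟫ = ∫_q Θᵗ_{Φ₁}(w̄)(q) · (star g₂)(q) dν = 0`
    have hT1 := inner_toLp_lineThetaLift_eq_integral L 2 H e₁ dV hdV hdV0 ιA hιA' lam hlam a'
      (hasThetaMajorants_lineThetaKernelDatum₂ L ι e₁ dV hdV hdV0 hpos lam hlam a') ν Φ₁ (star g₂) w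
    have hR : ∫ q, (∫ α, conj (w α) * toQuotFun (adelicGroupData (↥(maximalRealSubfield L)) L (IsCMField.complexConj L) 2 H)
          (fun y => (lineThetaKernelDatum L 2 e₁ dV hdV hdV0 lam hlam a'
            (hasThetaMajorants_lineThetaKernelDatum₂ L ι e₁ dV hdV hdV0 hpos lam hlam a')).thetaKer Φ₁ (QuotientGroup.mk (ιA y)⁻¹, q)) α ∂μ) *
          (star g₂) q ∂ν = 0 := by
      simp only [hall, zero_mul, integral_zero]
    -- the left side of (T1) as an honest integral against `w`
    have hL : ⟪w, MemLp.toLp _ (memLp_toQuotFun_lineThetaLift L 2 H e₁ dV hdV hdV0 ιA hιA' lam hlam a'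
        (hasThetaMajorants_lineThetaKernelDatum₂ L ι e₁ dV hdV hdV0 hpos lam hlam a') ν Φ₁ (star g₂) μ 2)⟫_ℂ =
        ∫ α, conj (w α) * (∫ q, toQuotFun (adelicGroupData (↥(maximalRealSubfield L)) L (IsCMField.complexConj L) 2 H)
          (fun y => (lineThetaKernelDatum L 2 e₁ dV hdV hdV0 lam hlam a'
            (hasThetaMajorants_lineThetaKernelDatum₂ L ι e₁ dV hdV hdV0 hpos lam hlam a')).thetaKer Φ₁ (QuotientGroup.mk (ιA y)⁻¹, q)) α *
          (star g₂) q ∂ν) ∂μ := by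
      rw [MeasureTheory.L2.inner_def]
      refine integral_congr_ae ?_
      filter_upwards [MemLp.coeFn_toLp (memLp_toQuotFun_lineThetaLift L 2 H e₁ dV hdV hdV0 ιA hιA' lam hlam a'
        (hasThetaMajorants_lineThetaKernelDatum₂ L ι e₁ dV hdV hdV0 hpos lam hlam a') ν Φ₁ (star g₂) μ 2)] with α hα
      rw [hα, RCLike.inner_apply, mul_comm,
        toQuotFun_lineThetaLift_eq_integral_toQuotFun_thetaKer L 2 H e₁ dV hdV hdV0 ιA hιA' lam hlam a'
          (hasThetaMajorants_lineThetaKernelDatum₂ L ι e₁ dV hdV hdV0 hpos lam hlam a') Φ₁ ν (star g₂) α]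
    have hstar : ∫ α, conj (w α) * (∫ q, toQuotFun (adelicGroupData (↥(maximalRealSubfield L)) L (IsCMField.complexConj L) 2 H)
          (fun y => (lineThetaKernelDatum L 2 e₁ dV hdV hdV0 lam hlam a'
            (hasThetaMajorants_lineThetaKernelDatum₂ L ι e₁ dV hdV hdV0 hpos lam hlam a')).thetaKer Φ₁ (QuotientGroup.mk (ιA y)⁻¹, q)) α *
          (star g₂) q ∂ν) ∂μ = 0 := by
      rw [← hL, hT1, hR]
    -- conjugate: `conj J(x₂)` is that integral
    have hconj : conj (∫ x₁, (∫ q, conj (toQuotFun (adelicGroupData (↥(maximalRealSubfield L)) L (IsCMField.complexConj L) 2 H)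
          (fun y => (lineThetaKernelDatum L 2 e₁ dV hdV hdV0 lam hlam a'
            (hasThetaMajorants_lineThetaKernelDatum₂ L ι e₁ dV hdV hdV0 hpos lam hlam a')).thetaKer Φ₁ (QuotientGroup.mk (ιA y)⁻¹, q)) x₁) *
        toQuotFun (adelicGroupData (↥(maximalRealSubfield L)) L (IsCMField.complexConj L) 2 H)
          (fun y => (lineThetaKernelDatum L 2 e₁ dV hdV hdV0 lam hlam a'
            (hasThetaMajorants_lineThetaKernelDatum₂ L ι e₁ dV hdV hdV0 hpos lam hlam a')).thetaKer Φ₂ (QuotientGroup.mk (ιA y)⁻¹, q)) x₂ ∂ν) *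
        w x₁ ∂μ) = 0 := by
      rw [← integral_conj]
      refine Eq.trans (integral_congr_ae (Filter.Eventually.of_forall fun x₁ => ?_)) hstar
      dsimp only
      rw [map_mul, mul_comm]
      congr 1
      rw [← integral_conj]
      refine integral_congr_ae (Filter.Eventually.of_forall fun q => ?_)
      dsimp only
      rw [map_mul, Complex.conj_conj, hf₂ap]
    have h := congrArg conj hconj
    rwa [Complex.conj_conj, map_zero] at h
  -- the doubling pairing vanishes for EVERY second slot `φ₂` (the twisted `χ_{D,½}·w′` is never inspected): Fubini on `[G] × [G]` when the
  -- integrand is integrable (junk `0` otherwise), inner integral `= J(x₂) · conj φ₂(x₂) = 0`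
  suffices hgen : ∀ φ₂ : (adelicGroupData (↥(maximalRealSubfield L)) L (IsCMField.complexConj L) 2 H).automorphicQuotient → ℂ,
      Literature.NumberTheory.K2Lit.SiegelDoubled.doublingPairing (adelicGroupData (↥(maximalRealSubfield L)) L (IsCMField.complexConj L) 2 H) μ
        (fun x => ∫ q, conj (toQuotFun (adelicGroupData (↥(maximalRealSubfield L)) L (IsCMField.complexConj L) 2 H)
            (fun y => (lineThetaKernelDatum L 2 e₁ dV hdV hdV0 lam hlam a'
              (hasThetaMajorants_lineThetaKernelDatum₂ L ι e₁ dV hdV hdV0 hpos lam hlam a')).thetaKer Φ₁ (QuotientGroup.mk (ιA y)⁻¹, q)) x.1) *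
          toQuotFun (adelicGroupData (↥(maximalRealSubfield L)) L (IsCMField.complexConj L) 2 H)
            (fun y => (lineThetaKernelDatum L 2 e₁ dV hdV hdV0 lam hlam a'
              (hasThetaMajorants_lineThetaKernelDatum₂ L ι e₁ dV hdV hdV0 hpos lam hlam a')).thetaKer Φ₂ (QuotientGroup.mk (ιA y)⁻¹, q)) x.2 ∂ν)
        (fun α => w α) φ₂ = 0 from hgen _
  intro φ₂
  unfold Literature.NumberTheory.K2Lit.SiegelDoubled.doublingPairing
  by_cases hint : Integrable (fun x : (adelicGroupData (↥(maximalRealSubfield L)) L (IsCMField.complexConj L) 2 H).automorphicQuotient ×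
        (adelicGroupData (↥(maximalRealSubfield L)) L (IsCMField.complexConj L) 2 H).automorphicQuotient =>
      (∫ q, conj (toQuotFun (adelicGroupData (↥(maximalRealSubfield L)) L (IsCMField.complexConj L) 2 H)
          (fun y => (lineThetaKernelDatum L 2 e₁ dV hdV hdV0 lam hlam a'
            (hasThetaMajorants_lineThetaKernelDatum₂ L ι e₁ dV hdV hdV0 hpos lam hlam a')).thetaKer Φ₁ (QuotientGroup.mk (ιA y)⁻¹, q)) x.1) *
        toQuotFun (adelicGroupData (↥(maximalRealSubfield L)) L (IsCMField.complexConj L) 2 H)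
          (fun y => (lineThetaKernelDatum L 2 e₁ dV hdV hdV0 lam hlam a'
            (hasThetaMajorants_lineThetaKernelDatum₂ L ι e₁ dV hdV hdV0 hpos lam hlam a')).thetaKer Φ₂ (QuotientGroup.mk (ιA y)⁻¹, q)) x.2 ∂ν) *
        w x.1 * conj (φ₂ x.2)) (μ.prod μ)
  · rw [integral_prod_symm _ hint]
    have hinner : ∀ x₂ : (adelicGroupData (↥(maximalRealSubfield L)) L (IsCMField.complexConj L) 2 H).automorphicQuotient,
        ∫ x₁, (∫ q, conj (toQuotFun (adelicGroupData (↥(maximalRealSubfield L)) L (IsCMField.complexConj L) 2 H)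
            (fun y => (lineThetaKernelDatum L 2 e₁ dV hdV hdV0 lam hlam a'
              (hasThetaMajorants_lineThetaKernelDatum₂ L ι e₁ dV hdV hdV0 hpos lam hlam a')).thetaKer Φ₁ (QuotientGroup.mk (ιA y)⁻¹, q)) x₁) *
          toQuotFun (adelicGroupData (↥(maximalRealSubfield L)) L (IsCMField.complexConj L) 2 H)
            (fun y => (lineThetaKernelDatum L 2 e₁ dV hdV hdV0 lam hlam a'
              (hasThetaMajorants_lineThetaKernelDatum₂ L ι e₁ dV hdV hdV0 hpos lam hlam a')).thetaKer Φ₂ (QuotientGroup.mk (ιA y)⁻¹, q)) x₂ ∂ν) *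
          w x₁ * conj (φ₂ x₂) ∂μ = 0 := fun x₂ => by
      rw [integral_mul_const, hJ x₂, zero_mul]
    simp only [hinner, integral_zero]
  · exact integral_undef hint

end Summit.HodgeConjecture.HodgeConjecture.Cruxes.HLiu418.K2LiuSeesawFubini

end
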